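import Literature.MathematicalPhysics.QuantumFieldTheory.PottsGaugeWilsonLoopTopologyGeneralQ
import Literature.MathematicalPhysics.QuantumFieldTheory.IsingGaugePottsDictionary
import HarnessLib

/-!
# The topological formula for Wilson-loop CORRELATIONS of Potts lattice gauge theory
# (Duncan–Schweinhart 2026, Theorem 6) on the finite torus — PROVED for every `q ≥ 1`

Eleventh file of the transcription of the Fortuin–Kasteleyn-type (plaquette random-cluster)
representation of `q`-state Potts lattice gauge theory (companions: `PlaquetteRandomCluster` — the
setting, readings (R1)–(R3), (R7) and the SCOPE caveat: `ℤ_q` ∕ Potts gauge theory only; nothing here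
bears on the Yang–Mills mass gap or on `BalabanLadder.IR`, in the `ym` ladder only the conditional
finite-`𝕋⁴` rung `BalabanLadder.UV` is closed by any route —, `PottsGaugeEdwardsSokal` (the coupling),
`PottsGaugeWilsonLoopTopologyGeneralQ` (Duncan–Schweinhart's Proposition 14 = Theorem 4 below:
`𝔼_ν(W_γ) = μ̃(V_γ)` for every `q ≥ 1` on `𝕋^d_L`)).

Source: P. Duncan, B. Schweinhart, *A topological formula for Potts lattice gauge theory correlations*,
arXiv:2607.02434 (v1, 2 Jul 2026) [DuncanSchweinhart2026] (read in `lit read arxiv:2607.02434`): p. 4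
**Definition 5** (for `γ, γ' ∈ Z_i(X)`, `V_{γ,γ'}` is the event `[γ] = [γ'] ≠ 0` in `H_i(P; ℤ_q)`) and
**Theorem 6** («Under the same hypotheses as Theorem 4,
`Cov_ν(W_γ, W_{γ'}^{-1}) = μ(V^#_{γ,γ'}) + Cov_μ(V^#_γ, V^#_{γ'})`» — `X = ℤ^d` or a box,
`# ∈ {f, w}`, every `q ∈ ℕ + 1`); proof p. 13 («the proof does not depend on the dimension or boundary
conditions. Using Proposition 4, `𝔼_ν(W_γ W_{γ'}^{-1}) = 𝔼_ν(f(γ - γ')) = μ([γ] = [γ']) =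
μ([γ] = [γ'] ≠ 0) + μ([γ] = [γ'] = 0) = μ(V_{γ,γ'}) + μ(V_γ ∩ V_{γ'})`», then subtract
`𝔼_ν(W_γ) 𝔼_ν(W_{γ'}^{-1}) = μ(V_γ) μ(V_{γ'})`).

We type it on the torus `X = 𝕋^d_L` (reading R7 of the companion files: the finite periodic volume,
where Theorem 4 ∕ Proposition 14 is the tree's `pottsExpect_wilsonLoopVar_eq_eventProbGrp`, every
`q ≥ 1`, every `ℤ_q` `1`-chain `γ`, every real `β`, the measure being the `|H¹(P;ℤ_q)|`-weighted
plaquette random-cluster model `eventProbGrp (ZMod q) (1 - e^{-β})`). The argument is the printed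
one, verbatim; `W_{γ'}^{-1} = W_{-γ'}` and `W_γ W_{γ'}^{-1} = W_{γ-γ'}` (`wilsonLoopVar` is a
character), and `V_γ` is a subgroup condition (`boundaryChains`), so `{[γ] = [γ']} = V_{γ-γ'}`
splits as `V_{γ,γ'} ⊔ (V_γ ∩ V_{γ'})`.
`-- TODO(general form): boxes with free ∕ wired boundary and X = ℤ^d (infinite volume), as printed.`

## Contents (everything PROVED; no named fact)

* `homologousNonzero q γ γ'` — Definition 5, the event `V_{γ,γ'} = {[γ] = [γ'] ≠ 0 ∈ H₁(P(ω); ℤ_q)}`;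
* `wilsonLoopVar_mul_inv` (`W_γ W_{γ'}^{-1} = W_{γ-γ'}`), `wilsonLoopVar_inv` (`W_{γ'}^{-1} = W_{-γ'}`);
* `pottsExpect_wilsonLoopVar_mul_inv_eq` — the first display of the proof:
  `𝔼_ν(W_γ W_{γ'}^{-1}) = μ̃([γ] = [γ']) = μ̃(V_{γ,γ'}) + μ̃(V_γ ∩ V_{γ'})`;
* **`pottsCov_wilsonLoopVar_eq`** — Theorem 6 on `𝕋^d_L`:
  `𝔼_ν(W_γ W_{γ'}^{-1}) - 𝔼_ν(W_γ) 𝔼_ν(W_{γ'}^{-1}) = μ̃(V_{γ,γ'}) + (μ̃(V_γ ∩ V_{γ'}) - μ̃(V_γ) μ̃(V_{γ'}))`.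

* (§ appended) **the plaquette-density dictionary** (Duncan–Schweinhart 2026, proof of Prop. 21, first
  two displays: `μ(σ ∈ P) = 𝒦(σ ∈ P, W_σ = 1) = p ν(W_σ = 1)` and
  `p^{-2} μ(σ ∈ P, τ ∈ P) = ν(W_σ = W_τ = 1)`), for EVERY finite set `S` of plaquettes and every finite
  abelian coefficient group `G`: `sum_ite_superset_esWeight` (the pinned marginal of the coupling,
  `Σ_{ω ⊇ S} κ(f, ω) = p^{|S|} 1{δf ≡ 0 on S} e^{-β|X²|} e^{-βH(f)}`),
  **`eventProbGrp_superset_eq`** (`μ̃(S ⊆ P) = p^{|S|} ν(δf(σ) = 0 ∀ σ ∈ S)`),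
  `cov_plaquetteOpen_eq` (`Cov_μ̃(σ ∈ P, τ ∈ P) = p² Cov_ν(1{δf(σ)=0}, 1{δf(τ)=0})`), and for `ℤ₂`
  **`cov_plaquetteOpen_eq_z2`** — Proposition 21 at `q = 2`:
  `Cov_ν(W_σ, W_τ) = (4/p²) Cov_μ̃(σ ∈ P, τ ∈ P)` («obviously self-dual when `q = 2`»).

Applications in the source (NOT typed; infinite volume): Thm 7 (finite correlation length at high
and low temperature, all `q ≥ 2`, `d ≥ 3`), Thm 8 (`ℤ₂` gauge theory in codimension two, i.e. genuine
`ℤ₂` lattice gauge theory on `ℤ³`: `0 < ξ_β < ∞` for all `β ≠ β*(β_c(2))`), Thm 9 (self-dual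
dimensions).
-/

open Finset

namespace Literature.MathematicalPhysics.QuantumFieldTheory

namespace PlaquetteRC

open LatticeForm

variable {d L : ℕ} [NeZero L] (n : ℕ) [NeZero n]

/-! ### Definition 5: the event `V_{γ,γ'}` -/

/-- **Definition 5 of Duncan–Schweinhart 2026**: for `1`-chains `γ, γ'` the event
`V_{γ,γ'} = {[γ] = [γ'] ≠ 0 in H₁(P(ω); ℤ_q)}` — `γ - γ'` bounds a surface of open plaquettes but
`γ` (equivalently `γ'`) does not. [cite: DuncanSchweinhart2026, Def. 5 (p. 4)] -/
def homologousNonzero (γ γ' : Site d L → Fin d → ZMod n) : Set (Finset (Plaquette d L)) :=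
  {ω | IsNullHomologousIn ω (γ - γ') ∧ ¬ IsNullHomologousIn ω γ}

omit [NeZero n] in
/-- Membership in `V_{γ,γ'}`. [cite: DuncanSchweinhart2026, Def. 5 (p. 4)] -/
@[simp] theorem mem_homologousNonzero {γ γ' : Site d L → Fin d → ZMod n} {ω : Finset (Plaquette d L)} :
    ω ∈ homologousNonzero n γ γ' ↔ IsNullHomologousIn ω (γ - γ') ∧ ¬ IsNullHomologousIn ω γ :=
  Iff.rfl

omit [NeZero n] in
/-- On `V_{γ,γ'}` neither loop bounds: `[γ'] ≠ 0` as well (the classes coincide).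
[cite: DuncanSchweinhart2026, Def. 5 (p. 4)] -/
theorem not_isNullHomologousIn_right_of_mem_homologousNonzero {γ γ' : Site d L → Fin d → ZMod n}
    {ω : Finset (Plaquette d L)} (h : ω ∈ homologousNonzero n γ γ') : ¬ IsNullHomologousIn ω γ' := by
  intro h'
  apply h.2
  have h1 : γ - γ' ∈ boundaryChains (ZMod n) ω := h.1
  have h2 : γ' ∈ boundaryChains (ZMod n) ω := h'
  have : γ = (γ - γ') + γ' := by abel
  rw [show IsNullHomologousIn ω γ ↔ γ ∈ boundaryChains (ZMod n) ω from Iff.rfl, this]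
  exact add_mem h1 h2

omit [NeZero n] in
/-- `V_{γ,γ'}` is symmetric in the two loops. [cite: DuncanSchweinhart2026, Def. 5 (p. 4)] -/
theorem homologousNonzero_comm (γ γ' : Site d L → Fin d → ZMod n) :
    homologousNonzero n γ γ' = homologousNonzero n γ' γ := by
  ext ω
  constructor
  · intro h
    refine ⟨?_, not_isNullHomologousIn_right_of_mem_homologousNonzero n h⟩
    have h1 : γ - γ' ∈ boundaryChains (ZMod n) ω := h.1
    have : γ' - γ = -(γ - γ') := by abel
    show γ' - γ ∈ boundaryChains (ZMod n) ω
    rw [this]; exact neg_mem h1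
  · intro h
    refine ⟨?_, not_isNullHomologousIn_right_of_mem_homologousNonzero n h⟩
    have h1 : γ' - γ ∈ boundaryChains (ZMod n) ω := h.1
    have : γ - γ' = -(γ' - γ) := by abel
    show γ - γ' ∈ boundaryChains (ZMod n) ω
    rw [this]; exact neg_mem h1

/-! ### Wilson loop variables form a character of the chain group -/

/-- The pairing is additive in the chain: `⟨θ, γ - γ'⟩ = ⟨θ, γ⟩ - ⟨θ, γ'⟩`. [cite: DuncanSchweinhart2026, proof of Thm 6 (W_γ W_{γ'}^{-1} = f(γ - γ'))] -/
theorem pairing_sub_right {R : Type*} [CommRing R] (θ γ γ' : Site d L → Fin d → R) :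
    pairing θ (γ - γ') = pairing θ γ - pairing θ γ' := by
  simp only [pairing, Pi.sub_apply, mul_sub, Finset.sum_sub_distrib]

/-- `⟨θ, -γ⟩ = -⟨θ, γ⟩`. [cite: DuncanSchweinhart2026, proof of Thm 6] -/
theorem pairing_neg_right {R : Type*} [CommRing R] (θ γ : Site d L → Fin d → R) :
    pairing θ (-γ) = -pairing θ γ := by
  simp only [pairing, Pi.neg_apply, mul_neg, Finset.sum_neg_distrib]

/-- **`W_γ W_{γ'}^{-1} = W_{γ - γ'}`** (the Wilson loop variable `f ↦ f(γ)^ℂ` is a character of the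
chain group; first step of the proof of Thm 6: `𝔼_ν(W_γ W_{γ'}^{-1}) = 𝔼_ν(f(γ - γ'))`).
[cite: DuncanSchweinhart2026, proof of Thm 6 (p. 13, first line)] -/
theorem wilsonLoopVar_mul_inv (γ γ' θ : Site d L → Fin d → ZMod n) :
    wilsonLoopVar n γ θ * (wilsonLoopVar n γ' θ)⁻¹ = wilsonLoopVar n (γ - γ') θ := by
  simp only [wilsonLoopVar]
  rw [pairing_sub_right, sub_eq_add_neg, AddChar.map_add_eq_mul, AddChar.map_neg_eq_inv]

/-- `W_{γ'}^{-1} = W_{-γ'}`. [cite: DuncanSchweinhart2026, proof of Thm 6 (p. 13)] -/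
theorem wilsonLoopVar_inv (γ' θ : Site d L → Fin d → ZMod n) :
    (wilsonLoopVar n γ' θ)⁻¹ = wilsonLoopVar n (-γ') θ := by
  simp only [wilsonLoopVar, pairing_neg_right, AddChar.map_neg_eq_inv]

/-! ### Theorem 6 on the torus -/

omit [NeZero n] in
/-- `V_{-γ'} = V_{γ'}` (null-homology is a subgroup condition). [cite: DuncanSchweinhart2026, proof of Thm 6 (𝔼_ν(W_{γ'}^{-1}) = μ(V_{γ'}))] -/
theorem setOf_isNullHomologousIn_neg (γ' : Site d L → Fin d → ZMod n) :
    {ω : Finset (Plaquette d L) | IsNullHomologousIn ω (-γ')} = {ω | IsNullHomologousIn ω γ'} := by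
  ext ω
  exact (boundaryChains (ZMod n) ω).neg_mem_iff

omit [NeZero n] in
/-- The decomposition `{[γ] = [γ']} = V_{γ,γ'} ⊔ (V_γ ∩ V_{γ'})`, at the level of the random-cluster
probabilities: `μ̃(V_{γ-γ'}) = μ̃(V_{γ,γ'}) + μ̃(V_γ ∩ V_{γ'})`.
[cite: DuncanSchweinhart2026, proof of Thm 6 (p. 13: μ([γ]=[γ']) = μ([γ]=[γ']≠0) + μ([γ]=[γ']=0))] -/
theorem eventProbGrp_sub_eq_add (p : ℝ) (γ γ' : Site d L → Fin d → ZMod n) :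
    eventProbGrp (d := d) (L := L) (ZMod n) p {ω | IsNullHomologousIn ω (γ - γ')} =
      eventProbGrp (d := d) (L := L) (ZMod n) p (homologousNonzero n γ γ') +
        eventProbGrp (d := d) (L := L) (ZMod n) p
          ({ω | IsNullHomologousIn ω γ} ∩ {ω | IsNullHomologousIn ω γ'}) := by
  classical
  unfold eventProbGrp
  rw [← Finset.sum_add_distrib]
  refine Finset.sum_congr rfl fun ω _ => ?_
  simp only [Set.mem_setOf_eq, mem_homologousNonzero, Set.mem_inter_iff]
  by_cases hγ : IsNullHomologousIn ω γ
  · -- `[γ] = 0`: then `[γ - γ'] = 0 ↔ [γ'] = 0`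
    have hiff : IsNullHomologousIn ω (γ - γ') ↔ IsNullHomologousIn ω γ' := by
      have hγm : γ ∈ boundaryChains (ZMod n) ω := hγ
      change γ - γ' ∈ boundaryChains (ZMod n) ω ↔ γ' ∈ boundaryChains (ZMod n) ω
      rw [sub_eq_add_neg, (boundaryChains (ZMod n) ω).add_mem_iff_right hγm,
        (boundaryChains (ZMod n) ω).neg_mem_iff]
    by_cases hγ' : IsNullHomologousIn ω γ'
    · simp [hγ, hγ', hiff.2 hγ']
    · simp [hγ, hγ', mt hiff.1 hγ']
  · by_cases h : IsNullHomologousIn ω (γ - γ')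
    · simp [hγ, h]
    · simp [hγ, h]

/-- **First display of the proof of Theorem 6** (Duncan–Schweinhart 2026, p. 13), on `𝕋^d_L`,
every `q ≥ 1`: `𝔼_ν(W_γ W_{γ'}^{-1}) = μ̃([γ] = [γ']) = μ̃(V_{γ,γ'}) + μ̃(V_γ ∩ V_{γ'})`, with
`μ̃ = μ̃_{1-e^{-β}, ℤ_q}` the `|H¹|`-weighted plaquette random-cluster model.
[cite: DuncanSchweinhart2026, Thm 6 (proof, p. 13, first display)] -/
theorem pottsExpect_wilsonLoopVar_mul_inv_eq (β : ℝ) (γ γ' : Site d L → Fin d → ZMod n) :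
    pottsExpect (d := d) (L := L) (ZMod n) β (fun θ => wilsonLoopVar n γ θ * (wilsonLoopVar n γ' θ)⁻¹) =
      (eventProbGrp (d := d) (L := L) (ZMod n) (esParam β) (homologousNonzero n γ γ') : ℂ) +
        eventProbGrp (d := d) (L := L) (ZMod n) (esParam β)
          ({ω | IsNullHomologousIn ω γ} ∩ {ω | IsNullHomologousIn ω γ'}) := by
  have h1 : (fun θ => wilsonLoopVar n γ θ * (wilsonLoopVar n γ' θ)⁻¹) = wilsonLoopVar n (γ - γ') := by
    funext θ; exact wilsonLoopVar_mul_inv n γ γ' θ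
  rw [h1, pottsExpect_wilsonLoopVar_eq_eventProbGrp, eventProbGrp_sub_eq_add]
  push_cast
  ring

/-- `𝔼_ν(W_{γ'}^{-1}) = μ̃(V_{γ'})` (Theorem 4 for `-γ'` and `V_{-γ'} = V_{γ'}`).
[cite: DuncanSchweinhart2026, Thm 6 (proof, p. 13: 𝔼_ν(W_γ)𝔼_ν(W_{γ'}^{-1}) = μ(V_γ)μ(V_{γ'}))] -/
theorem pottsExpect_wilsonLoopVar_inv_eq (β : ℝ) (γ' : Site d L → Fin d → ZMod n) :
    pottsExpect (d := d) (L := L) (ZMod n) β (fun θ => (wilsonLoopVar n γ' θ)⁻¹) =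
      (eventProbGrp (d := d) (L := L) (ZMod n) (esParam β) {ω | IsNullHomologousIn ω γ'} : ℂ) := by
  have h1 : (fun θ => (wilsonLoopVar n γ' θ)⁻¹) = wilsonLoopVar n (-γ') := by
    funext θ; exact wilsonLoopVar_inv n γ' θ
  rw [h1, pottsExpect_wilsonLoopVar_eq_eventProbGrp, setOf_isNullHomologousIn_neg]

/-- **Theorem 6 of Duncan–Schweinhart 2026 on the finite torus `𝕋^d_L`, every `q ≥ 1`, every pair of
`ℤ_q` `1`-chains `γ, γ'`, every real `β`** (the topological formula for Wilson-loop correlations):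
`Cov_ν(W_γ, W_{γ'}^{-1}) = μ̃(V_{γ,γ'}) + Cov_μ̃(V_γ, V_{γ'})`, i.e.
`𝔼_ν(W_γ W_{γ'}^{-1}) - 𝔼_ν(W_γ) 𝔼_ν(W_{γ'}^{-1}) = μ̃(V_{γ,γ'}) + (μ̃(V_γ ∩ V_{γ'}) - μ̃(V_γ) μ̃(V_{γ'}))`,
`ν = ν_{β,q}` Potts lattice gauge theory, `μ̃ = μ̃_{1-e^{-β},ℤ_q}` the `|H¹|`-weighted plaquette
random-cluster model (`eventProbGrp`). The printed statement is for boxes (free or wired) and `ℤ^d`;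
the proof «does not depend on the dimension or boundary conditions» and is reproduced here from the
torus form of Theorem 4 (`pottsExpect_wilsonLoopVar_eq_eventProbGrp`).
[cite: DuncanSchweinhart2026, Thm 6 (p. 4; proof p. 13)] -/
theorem pottsCov_wilsonLoopVar_eq (β : ℝ) (γ γ' : Site d L → Fin d → ZMod n) :
    pottsExpect (d := d) (L := L) (ZMod n) β (fun θ => wilsonLoopVar n γ θ * (wilsonLoopVar n γ' θ)⁻¹) -
        pottsExpect (d := d) (L := L) (ZMod n) β (wilsonLoopVar n γ) *
          pottsExpect (d := d) (L := L) (ZMod n) β (fun θ => (wilsonLoopVar n γ' θ)⁻¹) =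
      (eventProbGrp (d := d) (L := L) (ZMod n) (esParam β) (homologousNonzero n γ γ') : ℂ) +
        ((eventProbGrp (d := d) (L := L) (ZMod n) (esParam β)
            ({ω | IsNullHomologousIn ω γ} ∩ {ω | IsNullHomologousIn ω γ'}) : ℂ) -
          eventProbGrp (d := d) (L := L) (ZMod n) (esParam β) {ω | IsNullHomologousIn ω γ} *
            eventProbGrp (d := d) (L := L) (ZMod n) (esParam β) {ω | IsNullHomologousIn ω γ'}) := by
  rw [pottsExpect_wilsonLoopVar_mul_inv_eq, pottsExpect_wilsonLoopVar_inv_eq,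
    pottsExpect_wilsonLoopVar_eq_eventProbGrp]
  ring


/-! ### The plaquette-density dictionary (Duncan–Schweinhart 2026, proof of Proposition 21)

The Edwards–Sokal–Hiraoka–Shirai coupling `κ(f, ω)` (`esWeight`, Prop. 20/21 of the 2025 paper)
makes the open plaquettes, given the gauge field `f`, independent Bernoulli(`p`) on the flat
plaquettes `δf(σ) = 0` and closed elsewhere. Hence pinning a finite set `S` of plaquettes open costs
`p^{|S|}` and forces `δf ≡ 0` on `S`: `μ̃(S ⊆ P) = p^{|S|} ν(δf(σ) = 0 ∀ σ ∈ S)` — the displays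
`μ(σ ∈ P) = p ν(W_σ = 1)`, `p^{-2} μ(σ ∈ P, τ ∈ P) = ν(W_σ = W_τ = 1)` of the proof of Prop. 21
(`W_σ = 1 ⇔ δf(σ) = 0`). -/

section PlaquetteDensity

variable (G : Type*) [AddCommGroup G] [DecidableEq G] [Fintype G]

omit [NeZero n] in
/-- Splitting a sum over all plaquette configurations according to one plaquette `σ`:
`Σ_ω F(ω) = Σ_{t ∌ σ} F(t) + Σ_{t ∌ σ} F(t ∪ {σ})`. [folklore] -/
private theorem sum_split_insert (σ : Plaquette d L) (F : Finset (Plaquette d L) → ℝ) :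
    ∑ ω : Finset (Plaquette d L), F ω =
      ∑ t ∈ (Finset.univ.erase σ).powerset, F t +
        ∑ t ∈ (Finset.univ.erase σ).powerset, F (insert σ t) := by
  classical
  rw [← Finset.sum_powerset_insert (Finset.notMem_erase σ Finset.univ),
    Finset.insert_erase (Finset.mem_univ σ), Finset.powerset_univ]

omit [NeZero n] [Fintype G] in
/-- **Opening one more plaquette in the coupling** (Prop. 21 (1) of the 2025 paper: given `f`, the
plaquettes are independent, open with probability `p` where `δf = 0` and closed elsewhere): for
`σ ∉ ω`, `κ(f, ω ∪ {σ}) · (1 - p) = p · 1{δf(σ) = 0} · κ(f, ω)`.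
[cite: DuncanSchweinhart2026, Prop. 21 (proof, first display: μ(σ ∈ P) = 𝒦(σ ∈ P, W_σ = 1))] -/
theorem esWeight_insert_mul (β : ℝ) (θ : Site d L → Fin d → G) {ω : Finset (Plaquette d L)}
    {σ : Plaquette d L} (hσ : σ ∉ ω) :
    esWeight G β θ (insert σ ω) * (1 - esParam β) =
      esParam β * (if res (td₁ θ) σ = 0 then 1 else 0) * esWeight G β θ ω := by
  classical
  set g : Plaquette d L → ℝ := fun x =>
    if x ∈ ω then esParam β * (if res (td₁ θ) x = 0 then 1 else 0) else 1 - esParam β with hg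
  have h1 : esWeight G β θ (insert σ ω) =
      esParam β * (if res (td₁ θ) σ = 0 then 1 else 0) * ∏ x ∈ Finset.univ.erase σ, g x := by
    rw [esWeight, ← Finset.mul_prod_erase Finset.univ _ (Finset.mem_univ σ)]
    congr 1
    · simp
    · refine Finset.prod_congr rfl fun x hx => ?_
      have hxσ : x ≠ σ := Finset.ne_of_mem_erase hx
      simp [hg, Finset.mem_insert, hxσ]
  have h2 : esWeight G β θ ω = (1 - esParam β) * ∏ x ∈ Finset.univ.erase σ, g x := by
    rw [esWeight, ← Finset.mul_prod_erase Finset.univ _ (Finset.mem_univ σ)]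
    congr 1
    · simp [hσ]
  rw [h1, h2]
  ring

omit [NeZero n] [Fintype G] in
/-- **The pinned marginal of the coupling**: for every finite set `S` of plaquettes,
`Σ_{ω ⊇ S} κ(f, ω) = p^{|S|} · 1{δf(σ) = 0 ∀ σ ∈ S} · e^{-β|X²|} e^{-βH(f)}` (iterate
`esWeight_insert_mul` over `S`; the base case `S = ∅` is the first marginal of Prop. 20).
[cite: DuncanSchweinhart2026, Prop. 21 (proof, displays 1–2)] -/
theorem sum_ite_superset_esWeight (β : ℝ) (θ : Site d L → Fin d → G) (S : Finset (Plaquette d L)) :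
    ∑ ω : Finset (Plaquette d L), (if S ⊆ ω then esWeight G β θ ω else 0) =
      esParam β ^ S.card * (if ∀ σ ∈ S, res (td₁ θ) σ = 0 then (1 : ℝ) else 0) *
        (Real.exp (-β * Fintype.card (Plaquette d L)) * pottsWeight G β θ) := by
  classical
  induction S using Finset.induction_on with
  | empty => simp [sum_esWeight_eq_pottsWeight]
  | insert σ S hσS ih =>
    set p : ℝ := esParam β with hp
    set fl : ℝ := if res (td₁ θ) σ = 0 then 1 else 0 with hfl
    set A : ℝ := Real.exp (-β * Fintype.card (Plaquette d L)) * pottsWeight G β θ with hA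
    have hp1 : 1 - p ≠ 0 := by rw [hp, one_sub_esParam]; exact (Real.exp_pos _).ne'
    have hσt : ∀ t ∈ (Finset.univ.erase σ).powerset, σ ∉ t := fun t ht h =>
      Finset.notMem_erase σ Finset.univ (Finset.mem_powerset.1 ht h)
    have hiff : ∀ t : Finset (Plaquette d L), S ⊆ insert σ t ↔ S ⊆ t := by
      intro t
      constructor
      · intro h x hx
        rcases Finset.mem_insert.1 (h hx) with rfl | h'
        · exact (hσS hx).elim
        · exact h'
      · intro h; exact h.trans (Finset.subset_insert σ t)
    set B : ℝ := ∑ t ∈ (Finset.univ.erase σ).powerset, (if S ⊆ t then esWeight G β θ t else 0)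
      with hB
    set C : ℝ := ∑ t ∈ (Finset.univ.erase σ).powerset,
      (if S ⊆ t then esWeight G β θ (insert σ t) else 0) with hC
    -- `A_S = B + C`
    have hAS : ∑ ω : Finset (Plaquette d L), (if S ⊆ ω then esWeight G β θ ω else 0) = B + C := by
      rw [sum_split_insert σ]
      congr 1
      refine Finset.sum_congr rfl fun t _ => ?_
      simp only [hiff t]
    -- the new left-hand side is `C`
    have hL : ∑ ω : Finset (Plaquette d L), (if insert σ S ⊆ ω then esWeight G β θ ω else 0) = C := by
      rw [sum_split_insert σ]
      have h0 : ∑ t ∈ (Finset.univ.erase σ).powerset,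
          (if insert σ S ⊆ t then esWeight G β θ t else 0) = 0 :=
        Finset.sum_eq_zero fun t ht => if_neg fun h => hσt t ht (h (Finset.mem_insert_self σ S))
      rw [h0, zero_add]
      refine Finset.sum_congr rfl fun t _ => ?_
      have : insert σ S ⊆ insert σ t ↔ S ⊆ t := by
        rw [Finset.insert_subset_iff]
        simp only [Finset.mem_insert_self, true_and, hiff t]
      simp only [this]
    -- `(1 - p) C = p · 1{flat σ} · B`
    have hBC : (1 - p) * C = p * fl * B := by
      rw [hC, hB, Finset.mul_sum, Finset.mul_sum]
      refine Finset.sum_congr rfl fun t ht => ?_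
      by_cases hSt : S ⊆ t
      · rw [if_pos hSt, if_pos hSt]
        have key := esWeight_insert_mul G β θ (hσt t ht)
        rw [← hp, ← hfl] at key
        linear_combination key
      · rw [if_neg hSt, if_neg hSt, mul_zero, mul_zero]
    have hIH : B + C = p ^ S.card * (if ∀ ρ ∈ S, res (td₁ θ) ρ = 0 then (1 : ℝ) else 0) * A := by
      rw [← hAS]; exact ih
    have hflat : (if ∀ ρ ∈ insert σ S, res (td₁ θ) ρ = 0 then (1 : ℝ) else 0) =
        fl * (if ∀ ρ ∈ S, res (td₁ θ) ρ = 0 then (1 : ℝ) else 0) := by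
      simp only [Finset.forall_mem_insert, hfl]
      by_cases h₁ : res (td₁ θ) σ = 0 <;> simp [h₁]
    rw [hL, Finset.card_insert_of_notMem hσS, pow_succ, hflat]
    by_cases hf : res (td₁ θ) σ = 0
    · have hfl1 : fl = 1 := if_pos hf
      rw [hfl1] at hBC ⊢
      have hC' : C = p * (B + C) := by linear_combination hBC
      rw [hC', hIH]
      ring
    · have hfl0 : fl = 0 := if_neg hf
      rw [hfl0] at hBC ⊢
      have hC0 : C = 0 := by
        have h0 : (1 - p) * C = 0 := by rw [hBC]; ring
        rcases mul_eq_zero.1 h0 with h | h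
        · exact absurd h hp1
        · exact h
      rw [hC0]
      ring

/-- **The plaquette-density dictionary** (Duncan–Schweinhart 2026, proof of Prop. 21, displays 1–2,
for an arbitrary finite set of plaquettes and every finite abelian coefficient group): under the
`|H¹|`-weighted plaquette random-cluster model `μ̃ = μ̃_{1-e^{-β},G}` and Potts lattice gauge theory
`ν = ν_{β,G}` on `𝕋^d_L`,
`μ̃(S ⊆ P) = p^{|S|} · ν(δf(σ) = 0 for all σ ∈ S)`, `p = 1 - e^{-β}`, every real `β`
(for `S = {σ}`: `μ(σ ∈ P) = p ν(W_σ = 1)`; for `S = {σ, τ}`: `μ(σ ∈ P, τ ∈ P) = p² ν(W_σ = W_τ = 1)`).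
[cite: DuncanSchweinhart2026, Prop. 21 (proof, displays 1–2)] -/
theorem eventProbGrp_superset_eq (β : ℝ) (S : Finset (Plaquette d L)) :
    eventProbGrp (d := d) (L := L) G (esParam β) {ω | S ⊆ ω} =
      esParam β ^ S.card *
        ∑ θ : Site d L → Fin d → G, (if ∀ σ ∈ S, res (td₁ θ) σ = 0 then pottsProb G β θ else 0) := by
  classical
  have hEpos : 0 < Real.exp (-β * Fintype.card (Plaquette d L)) := Real.exp_pos _
  have hNBpos : (0 : ℝ) < (Nat.card (gradCochains (d := d) (L := L) ℤ G) : ℝ) := by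
    exact_mod_cast Nat.card_pos (α := gradCochains (d := d) (L := L) ℤ G)
  have hZpos := pottsPartitionFn_pos (d := d) (L := L) G β
  -- `E 𝒵 = NB Z̃` (Prop. 20, both marginals; as `pottsPartitionFn_eq_grp` for `ℤ_q`)
  have hden : Real.exp (-β * Fintype.card (Plaquette d L)) * pottsPartitionFn (d := d) (L := L) G β =
      (Nat.card (gradCochains (d := d) (L := L) ℤ G) : ℝ) *
        partitionFnGrp (d := d) (L := L) G (esParam β) := by
    unfold pottsPartitionFn partitionFnGrp
    rw [Finset.mul_sum]
    simp_rw [← sum_esWeight_eq_pottsWeight]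
    rw [Finset.sum_comm, Finset.mul_sum]
    refine Finset.sum_congr rfl fun ω _ => ?_
    rw [sum_esWeight_eq_weightGrp]
  have hZtpos : 0 < partitionFnGrp (d := d) (L := L) G (esParam β) := by
    have h := mul_pos hEpos hZpos
    rw [hden] at h
    exact (mul_pos_iff_of_pos_left hNBpos).mp h
  -- numerator: `NB Σ_ω 1{S ⊆ ω} weightGrp ω = Σ_θ Σ_ω 1{S ⊆ ω} κ(θ, ω) = p^{|S|} E Σ_θ 1{flat_S} w(θ)`
  have hnum : (Nat.card (gradCochains (d := d) (L := L) ℤ G) : ℝ) *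
      ∑ ω : Finset (Plaquette d L),
        (if S ⊆ ω then weightGrp (d := d) (L := L) G (esParam β) ω else 0) =
      esParam β ^ S.card * (Real.exp (-β * Fintype.card (Plaquette d L)) *
        ∑ θ : Site d L → Fin d → G,
          (if ∀ σ ∈ S, res (td₁ θ) σ = 0 then (1 : ℝ) else 0) * pottsWeight G β θ) := by
    rw [Finset.mul_sum]
    have h1 : ∀ ω : Finset (Plaquette d L),
        (Nat.card (gradCochains (d := d) (L := L) ℤ G) : ℝ) *
          (if S ⊆ ω then weightGrp (d := d) (L := L) G (esParam β) ω else 0) =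
          ∑ θ : Site d L → Fin d → G, (if S ⊆ ω then esWeight G β θ ω else 0) := by
      intro ω
      split_ifs with h
      · rw [sum_esWeight_eq_weightGrp]
      · simp
    rw [Finset.sum_congr rfl fun ω _ => h1 ω, Finset.sum_comm]
    rw [Finset.sum_congr rfl fun θ _ => sum_ite_superset_esWeight G β θ S, Finset.mul_sum,
      Finset.mul_sum]
    refine Finset.sum_congr rfl fun θ _ => ?_
    ring
  -- the two sides as quotients
  have hL : eventProbGrp (d := d) (L := L) G (esParam β) {ω | S ⊆ ω} =
      (∑ ω : Finset (Plaquette d L),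
        (if S ⊆ ω then weightGrp (d := d) (L := L) G (esParam β) ω else 0)) /
        partitionFnGrp (d := d) (L := L) G (esParam β) := by
    unfold eventProbGrp probGrp
    rw [Finset.sum_div]
    refine Finset.sum_congr rfl fun ω _ => ?_
    by_cases h : S ⊆ ω
    · rw [if_pos (show ω ∈ {ω : Finset (Plaquette d L) | S ⊆ ω} from h), if_pos h]
    · rw [if_neg (show ω ∉ {ω : Finset (Plaquette d L) | S ⊆ ω} from h), if_neg h, zero_div]
  have hR : ∑ θ : Site d L → Fin d → G, (if ∀ σ ∈ S, res (td₁ θ) σ = 0 then pottsProb G β θ else 0) =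
      (∑ θ : Site d L → Fin d → G,
        (if ∀ σ ∈ S, res (td₁ θ) σ = 0 then (1 : ℝ) else 0) * pottsWeight G β θ) /
        pottsPartitionFn (d := d) (L := L) G β := by
    unfold pottsProb
    rw [Finset.sum_div]
    refine Finset.sum_congr rfl fun θ _ => ?_
    split_ifs <;> simp
  rw [hL, hR, div_eq_iff hZtpos.ne', mul_div_assoc', div_mul_eq_mul_div, eq_div_iff hZpos.ne']
  -- clear denominators using `hnum` and `hden`
  have hNB0 : (Nat.card (gradCochains (d := d) (L := L) ℤ G) : ℝ) ≠ 0 := hNBpos.ne'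
  apply mul_left_cancel₀ hNB0
  rw [← mul_assoc, hnum]
  linear_combination (esParam β ^ S.card *
    ∑ θ : Site d L → Fin d → G,
      (if ∀ σ ∈ S, res (td₁ θ) σ = 0 then (1 : ℝ) else 0) * pottsWeight G β θ) * hden

/-- One plaquette: `μ̃(σ ∈ P) = p · ν(δf(σ) = 0)` («`μ(σ ∈ P) = p ν(W_σ = 1)`»).
[cite: DuncanSchweinhart2026, Prop. 21 (proof, first display)] -/
theorem eventProbGrp_mem_eq (β : ℝ) (σ : Plaquette d L) :
    eventProbGrp (d := d) (L := L) G (esParam β) {ω | σ ∈ ω} =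
      esParam β * ∑ θ : Site d L → Fin d → G, (if res (td₁ θ) σ = 0 then pottsProb G β θ else 0) := by
  have h := eventProbGrp_superset_eq (d := d) (L := L) G β {σ}
  simp only [Finset.singleton_subset_iff, Finset.card_singleton, pow_one, Finset.mem_singleton,
    forall_eq] at h
  exact h

/-- Two plaquettes: `μ̃(σ ∈ P, τ ∈ P) = p² · ν(δf(σ) = 0 ∧ δf(τ) = 0)` for `σ ≠ τ`
(«`p^{-2} μ(σ ∈ P, τ ∈ P) = ν(W_σ = W_τ = 1)`»). [cite: DuncanSchweinhart2026, Prop. 21 (proof, second display)] -/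
theorem eventProbGrp_mem_mem_eq (β : ℝ) {σ τ : Plaquette d L} (hστ : σ ≠ τ) :
    eventProbGrp (d := d) (L := L) G (esParam β) {ω | σ ∈ ω ∧ τ ∈ ω} =
      esParam β ^ 2 * ∑ θ : Site d L → Fin d → G,
        (if res (td₁ θ) σ = 0 ∧ res (td₁ θ) τ = 0 then pottsProb G β θ else 0) := by
  classical
  have h := eventProbGrp_superset_eq (d := d) (L := L) G β {σ, τ}
  have hcard : ({σ, τ} : Finset (Plaquette d L)).card = 2 := Finset.card_pair hστ
  simp only [hcard, Finset.insert_subset_iff, Finset.singleton_subset_iff, Finset.forall_mem_insert,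
    Finset.mem_singleton, forall_eq] at h
  exact h

/-- **Covariance of plaquette occupations = `p²` × covariance of flatness indicators**
(Duncan–Schweinhart 2026, proof of Prop. 21, the step common to all `q`): for `σ ≠ τ`,
`μ̃(σ, τ ∈ P) - μ̃(σ ∈ P) μ̃(τ ∈ P) = p² [ν(δf(σ) = 0 = δf(τ)) - ν(δf(σ) = 0) ν(δf(τ) = 0)]`.
[cite: DuncanSchweinhart2026, Prop. 21 (proof)] -/
theorem cov_plaquetteOpen_eq (β : ℝ) {σ τ : Plaquette d L} (hστ : σ ≠ τ) :
    eventProbGrp (d := d) (L := L) G (esParam β) {ω | σ ∈ ω ∧ τ ∈ ω} -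
        eventProbGrp (d := d) (L := L) G (esParam β) {ω | σ ∈ ω} *
          eventProbGrp (d := d) (L := L) G (esParam β) {ω | τ ∈ ω} =
      esParam β ^ 2 *
        ((∑ θ : Site d L → Fin d → G,
            (if res (td₁ θ) σ = 0 ∧ res (td₁ θ) τ = 0 then pottsProb G β θ else 0)) -
          (∑ θ : Site d L → Fin d → G, (if res (td₁ θ) σ = 0 then pottsProb G β θ else 0)) *
            ∑ θ : Site d L → Fin d → G, (if res (td₁ θ) τ = 0 then pottsProb G β θ else 0)) := by
  rw [eventProbGrp_mem_mem_eq G β hστ, eventProbGrp_mem_eq G β σ, eventProbGrp_mem_eq G β τ]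
  ring

end PlaquetteDensity

/-! ### Proposition 21 at `q = 2`: `Cov_ν(W_σ, W_τ) = (4/p²) Cov_μ̃(σ ∈ P, τ ∈ P)` -/

section IsingCase

open IsingGaugeCurrents

/-- For `ℤ₂` the Wilson plaquette variable is `±1` and `1{δf(σ) = 0} = (1 + W_σ)/2`:
`W_{∂σ}(f) = ρ(δf(σ))` with `ρ` the sign character. [cite: DuncanSchweinhart2026, Prop. 21 (proof: on V_σ … W_σ = 1 ⇔ δf(σ) = 0); ForsstromViklund2025currents §1.1 (ρ)] -/
theorem wilsonLoopVar_two_plaquette (σ : Plaquette d L) (θ : Site d L → Fin d → ZMod 2) :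
    wilsonLoopVar 2 (bd₂ (plaqInd (R := ZMod 2) σ)) θ = (spin (res (td₁ θ) σ) : ℂ) := by
  classical
  rw [wilsonLoopVar, ← res_td₁_eq_pairing_bd₂, stdAddChar_two]

omit [NeZero L] in
/-- The flatness indicator of `ℤ₂` gauge theory in terms of the Wilson plaquette:
`1{δf(σ) = 0} = (1 + ρ(δf(σ)))/2`. [cite: DuncanSchweinhart2026, Prop. 21 (proof, q = 2)] -/
theorem ite_flat_eq_spin (σ : Plaquette d L) (θ : Site d L → Fin d → ZMod 2) :
    (if res (td₁ θ) σ = 0 then (1 : ℝ) else 0) = (1 + spin (res (td₁ θ) σ)) / 2 := by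
  unfold spin
  split_ifs <;> norm_num

/-- **Proposition 21 of Duncan–Schweinhart 2026 at `q = 2`, on the torus** (`W_τ^{-1} = W_τ` and the
term `(q-2)/(q-1) μ(V_{σ,τ})` vanishes; «this expression is obviously self-dual when `q = 2`»): for
plaquettes `σ ≠ τ` of `𝕋^d_L` and every real `β`, with `p = 1 - e^{-β}`,
`Cov_ν(W_σ, W_τ) = (4/p²) Cov_μ̃(σ ∈ P, τ ∈ P)`, written multiplied out:
`p² (𝔼_ν(W_σ W_τ) - 𝔼_ν(W_σ) 𝔼_ν(W_τ)) = 4 (μ̃(σ, τ ∈ P) - μ̃(σ ∈ P) μ̃(τ ∈ P))`, the `ν`-averages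
being the real Boltzmann averages `Σ_θ ν(θ) ρ(δθ(σ)) ρ(δθ(τ))` etc. of the `±1` plaquette variables.
[cite: DuncanSchweinhart2026, Prop. 21 (q = 2)] -/
theorem cov_plaquetteOpen_eq_z2 (β : ℝ) {σ τ : Plaquette d L} (hστ : σ ≠ τ) :
    esParam β ^ 2 *
        ((∑ θ : Site d L → Fin d → ZMod 2, pottsProb (ZMod 2) β θ * (spin (res (td₁ θ) σ) * spin (res (td₁ θ) τ))) -
          (∑ θ : Site d L → Fin d → ZMod 2, pottsProb (ZMod 2) β θ * spin (res (td₁ θ) σ)) *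
            ∑ θ : Site d L → Fin d → ZMod 2, pottsProb (ZMod 2) β θ * spin (res (td₁ θ) τ)) =
      4 * (eventProbGrp (d := d) (L := L) (ZMod 2) (esParam β) {ω | σ ∈ ω ∧ τ ∈ ω} -
        eventProbGrp (d := d) (L := L) (ZMod 2) (esParam β) {ω | σ ∈ ω} *
          eventProbGrp (d := d) (L := L) (ZMod 2) (esParam β) {ω | τ ∈ ω}) := by
  rw [cov_plaquetteOpen_eq (ZMod 2) β hστ]
  -- rewrite the indicators through `(1 + ρ)/2` and use `Σ_θ ν(θ) = 1`
  have h1 : ∀ θ : Site d L → Fin d → ZMod 2,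
      (if res (td₁ θ) σ = 0 ∧ res (td₁ θ) τ = 0 then pottsProb (ZMod 2) β θ else 0) =
        pottsProb (ZMod 2) β θ * ((1 + spin (res (td₁ θ) σ)) / 2 * ((1 + spin (res (td₁ θ) τ)) / 2)) := by
    intro θ
    rw [← ite_flat_eq_spin, ← ite_flat_eq_spin]
    split_ifs with h h₁ h₂ <;> simp_all
  have h2 : ∀ (ρ : Plaquette d L) (θ : Site d L → Fin d → ZMod 2),
      (if res (td₁ θ) ρ = 0 then pottsProb (ZMod 2) β θ else 0) =
        pottsProb (ZMod 2) β θ * ((1 + spin (res (td₁ θ) ρ)) / 2) := by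
    intro ρ θ
    rw [← ite_flat_eq_spin]
    split_ifs <;> simp
  simp_rw [h1, h2]
  have hsum : ∑ θ : Site d L → Fin d → ZMod 2, pottsProb (ZMod 2) β θ = 1 := sum_pottsProb_eq_one (ZMod 2) β
  -- expand
  have e1 : ∑ θ : Site d L → Fin d → ZMod 2,
      pottsProb (ZMod 2) β θ * ((1 + spin (res (td₁ θ) σ)) / 2 * ((1 + spin (res (td₁ θ) τ)) / 2)) =
        (1 + ∑ θ : Site d L → Fin d → ZMod 2, pottsProb (ZMod 2) β θ * spin (res (td₁ θ) σ) +
          ∑ θ : Site d L → Fin d → ZMod 2, pottsProb (ZMod 2) β θ * spin (res (td₁ θ) τ) +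
          ∑ θ : Site d L → Fin d → ZMod 2,
            pottsProb (ZMod 2) β θ * (spin (res (td₁ θ) σ) * spin (res (td₁ θ) τ))) / 4 := by
    have h3 : ∀ θ : Site d L → Fin d → ZMod 2,
        pottsProb (ZMod 2) β θ * ((1 + spin (res (td₁ θ) σ)) / 2 * ((1 + spin (res (td₁ θ) τ)) / 2)) =
          (pottsProb (ZMod 2) β θ + pottsProb (ZMod 2) β θ * spin (res (td₁ θ) σ) +
            pottsProb (ZMod 2) β θ * spin (res (td₁ θ) τ) +
            pottsProb (ZMod 2) β θ * (spin (res (td₁ θ) σ) * spin (res (td₁ θ) τ))) / 4 := by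
      intro θ; ring
    simp_rw [h3]
    rw [← Finset.sum_div, Finset.sum_add_distrib, Finset.sum_add_distrib, Finset.sum_add_distrib, hsum]
  have e2 : ∀ ρ : Plaquette d L, ∑ θ : Site d L → Fin d → ZMod 2,
      pottsProb (ZMod 2) β θ * ((1 + spin (res (td₁ θ) ρ)) / 2) =
        (1 + ∑ θ : Site d L → Fin d → ZMod 2, pottsProb (ZMod 2) β θ * spin (res (td₁ θ) ρ)) / 2 := by
    intro ρ
    have h3 : ∀ θ : Site d L → Fin d → ZMod 2,
        pottsProb (ZMod 2) β θ * ((1 + spin (res (td₁ θ) ρ)) / 2) =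
          (pottsProb (ZMod 2) β θ + pottsProb (ZMod 2) β θ * spin (res (td₁ θ) ρ)) / 2 := by
      intro θ; ring
    simp_rw [h3]
    rw [← Finset.sum_div, Finset.sum_add_distrib, hsum]
  rw [e1, e2 σ, e2 τ]
  ring

end IsingCase

end PlaquetteRC

end Literature.MathematicalPhysics.QuantumFieldTheory
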